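import Summits.QuantumFields.BalabanUV.Beta.FP.MatrixInvDeriv

/-!
# `BalabanUV.Beta.FP.SliceLeibnizChain` — road «FP» for binder row D1, leaf H2-P, row H2-P-B (generic half, 1∕2): THIRD-ORDER LEIBNIZ CHAINS ALONG A
# REAL PARAMETER — matrix × matrix (entrywise) and scalar × scalar — members NAMED, `HasDerivAt` links, letter bounds, and the POWER COUNTING that turns
# graded letters `O(r^{a−j})` into graded products (the reciprocal chain is the sibling `FP/SliceReciprocalChain`)

HONEST DEPENDENCY (page 1, mandatory): continuum YM on T⁴ ⇐ BetaPertH ∧ nine spine estimates (0/9 proved); BetaPertH ⇐ (D1) ∧ (D4) ∧ CAP+tail;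
G-an2-4 gates asym, D1 and NE2/3/4.  HONEST FRAMING (cell contract, verbatim): «discharging `BetaPertH` makes Bałaban's UV stability UNCONDITIONAL —
a real constructive-QFT result; it is NOT the continuum limit and NOT the Clay problem.»  THIS MODULE DISCHARGES NOTHING of the wall: [folklore] one-variable
calculus (Mathlib `HasDerivAt.mul`) and arithmetic over `FP/MatrixInvDeriv` (entrywise Leibniz for matrix curves).  Data defs = NAMES for explicit
polynomial∕rational expressions (the chain members); no `def … : Prop`; nothing cited as a hypothesis; 0 sorry; 0 wall binders; NOT D1, NOT BetaPertH, NOT continuum,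
NOT Clay.

ABSOLUTE RULE (cell charter, verbatim): «No internally-minted statement may enter as a cited fact. Every hypothesis is either kernel-proved in this package or a
verbatim quotation of a PUBLISHED theorem with page reference. The manuscript(s) under audit are NOT citable for their own disputed steps — they are the thing
under adjudication; programme-internal (2001/route/tribunal) claims are never citable.»

WHAT (all chains POINTWISE at one parameter `t`; "letters" = sup bounds of the chain members at `t`):
* §1 MATRIX × MATRIX (entrywise; `X₀…X₃, Y₀…Y₃ : ℝ → Matrix ι ι ℂ`): `mm1 := X₁Y₀ + X₀Y₁`, `mm2`, `mm3` (Leibniz expansions, duplicated terms kept), `hasDerivAt_mm0∕1∕2`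
  (entrywise `HasDerivAt`, from `MatrixInvDeriv.hasDerivAt_mul_entry`), entry bounds `norm_mm1∕2∕3_le` (`n = Fintype.card ι` explicit).
* §2 SCALAR × SCALAR (`u₀…u₃, z₀…z₃ : ℝ → ℂ`): `ss1∕2∕3`, `hasDerivAt_ss0∕1∕2`, `norm_ss1∕2∕3_le`.
* §4 POWER COUNTING (`0 < r`): matrix letters `‖X_j‖ ≤ a∕r^{2+j}`, `‖Y_j‖ ≤ b·r^{4−j}` ⟹ `‖mm_k α β‖ ≤ 2^k·n·a·b·r^{2−k}` (stated per k);
  scalar letters `|u_j| ≤ 2^j·K·r^{2−j}`, `|z_j| ≤ c∕r^{2+j}` ⟹ `|ss_k| ≤ 3^k·K·c∕r^k` — the gradings of row H2-P-B (with `FP/SliceReciprocalChain` for `(2ε)⁻¹`): `B = −P·maxwellMat(W−1)·(2ε)⁻¹` with `P_j = O(‖s‖^{−2−j})` (H2-P-INV), `maxwellMat(W−1)_j = O(‖s‖^{4−j})` (H2-P-REG), `(2ε)⁻¹_j =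
  O(‖s‖^{−2−j})` (§3–§4 here) ⟹ `∂ᵏB = O(‖s‖^{−k})`.
Provenance: G-an2-4 swarm leaf prover 05, gen 34 (prover-b2b-balaban-gan24-formalise-leaf-05-g34-0), cross-lane on road FP (row H2-P-B claim l.20249), 2026-08-20.
-/

noncomputable section

namespace Summit.QuantumFields.BalabanUV.Beta.FP.SliceLeibnizChain

open Matrix Filter Finset
open scoped BigOperators
open Summit.QuantumFields.BalabanUV.Beta.FP.MatrixInvDeriv (hasDerivAt_mul_entry)

variable {ι : Type*} [Fintype ι] [DecidableEq ι]

/-! ## §1 Matrix × matrix, entrywise, to order three -/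

section MM

variable (X₀ X₁ X₂ X₃ Y₀ Y₁ Y₂ Y₃ : ℝ → Matrix ι ι ℂ)

/-- [our object] first Leibniz member `X₁Y₀ + X₀Y₁`. -/
def mm1 (s : ℝ) : Matrix ι ι ℂ := X₁ s * Y₀ s + X₀ s * Y₁ s
/-- [our object] second Leibniz member `(X₂Y₀ + X₁Y₁) + (X₁Y₁ + X₀Y₂)`. -/
def mm2 (s : ℝ) : Matrix ι ι ℂ := (X₂ s * Y₀ s + X₁ s * Y₁ s) + (X₁ s * Y₁ s + X₀ s * Y₂ s)
/-- [our object] third Leibniz member (eight terms). -/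
def mm3 (s : ℝ) : Matrix ι ι ℂ :=
  ((X₃ s * Y₀ s + X₂ s * Y₁ s) + (X₂ s * Y₁ s + X₁ s * Y₂ s)) + ((X₂ s * Y₁ s + X₁ s * Y₂ s) + (X₁ s * Y₂ s + X₀ s * Y₃ s))

variable {X₀ X₁ X₂ X₃ Y₀ Y₁ Y₂ Y₃} {t : ℝ}
  (hX0 : ∀ α β, HasDerivAt (fun s => X₀ s α β) (X₁ t α β) t) (hX1 : ∀ α β, HasDerivAt (fun s => X₁ s α β) (X₂ t α β) t)
  (hX2 : ∀ α β, HasDerivAt (fun s => X₂ s α β) (X₃ t α β) t)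
  (hY0 : ∀ α β, HasDerivAt (fun s => Y₀ s α β) (Y₁ t α β) t) (hY1 : ∀ α β, HasDerivAt (fun s => Y₁ s α β) (Y₂ t α β) t)
  (hY2 : ∀ α β, HasDerivAt (fun s => Y₂ s α β) (Y₃ t α β) t)

include hX0 hY0 in
/-- [folklore] `((X₀Y₀) α β)′ = mm1 α β`. -/
theorem hasDerivAt_mm0 (α β : ι) : HasDerivAt (fun s => (X₀ s * Y₀ s) α β) (mm1 X₀ X₁ Y₀ Y₁ t α β) t := by
  unfold mm1; exact hasDerivAt_mul_entry hX0 hY0 α β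

include hX0 hX1 hY0 hY1 in
/-- [folklore] `(mm1 α β)′ = mm2 α β`. -/
theorem hasDerivAt_mm1 (α β : ι) : HasDerivAt (fun s => mm1 X₀ X₁ Y₀ Y₁ s α β) (mm2 X₀ X₁ X₂ Y₀ Y₁ Y₂ t α β) t := by
  have h1 := hasDerivAt_mul_entry hX1 hY0 α β
  have h2 := hasDerivAt_mul_entry hX0 hY1 α β
  have h := h1.add h2
  have e1 : (fun s => mm1 X₀ X₁ Y₀ Y₁ s α β) = fun s => (X₁ s * Y₀ s) α β + (X₀ s * Y₁ s) α β := by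
    funext s; simp only [mm1, Matrix.add_apply]
  have e2 : mm2 X₀ X₁ X₂ Y₀ Y₁ Y₂ t α β = (X₂ t * Y₀ t + X₁ t * Y₁ t) α β + (X₁ t * Y₁ t + X₀ t * Y₂ t) α β := by
    simp only [mm2, Matrix.add_apply]
  rw [e1, e2]; exact h

include hX0 hX1 hX2 hY0 hY1 hY2 in
/-- [folklore] `(mm2 α β)′ = mm3 α β`. -/
theorem hasDerivAt_mm2 (α β : ι) :
    HasDerivAt (fun s => mm2 X₀ X₁ X₂ Y₀ Y₁ Y₂ s α β) (mm3 X₀ X₁ X₂ X₃ Y₀ Y₁ Y₂ Y₃ t α β) t := by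
  have h := ((hasDerivAt_mul_entry hX2 hY0 α β).add (hasDerivAt_mul_entry hX1 hY1 α β)).add
    ((hasDerivAt_mul_entry hX1 hY1 α β).add (hasDerivAt_mul_entry hX0 hY2 α β))
  have e1 : (fun s => mm2 X₀ X₁ X₂ Y₀ Y₁ Y₂ s α β)
      = fun s => ((X₂ s * Y₀ s) α β + (X₁ s * Y₁ s) α β) + ((X₁ s * Y₁ s) α β + (X₀ s * Y₂ s) α β) := by
    funext s; simp only [mm2, Matrix.add_apply]
  have e2 : mm3 X₀ X₁ X₂ X₃ Y₀ Y₁ Y₂ Y₃ t α β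
      = ((X₃ t * Y₀ t + X₂ t * Y₁ t) α β + (X₂ t * Y₁ t + X₁ t * Y₂ t) α β)
        + ((X₂ t * Y₁ t + X₁ t * Y₂ t) α β + (X₁ t * Y₂ t + X₀ t * Y₃ t) α β) := by
    simp only [mm3, Matrix.add_apply]
  rw [e1, e2]; exact h

omit [DecidableEq ι] in
/-- [folklore] `‖(M·N) α β‖ ≤ n·m·m′` from entrywise bounds. -/
theorem norm_mul_entry_le {M N : Matrix ι ι ℂ} {m m' : ℝ} (hM : ∀ α β, ‖M α β‖ ≤ m) (hN : ∀ α β, ‖N α β‖ ≤ m') (α β : ι) :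
    ‖(M * N) α β‖ ≤ Fintype.card ι * (m * m') := by
  rw [Matrix.mul_apply]
  have h0 : 0 ≤ m := (norm_nonneg _).trans (hM α α)
  calc ‖∑ γ, M α γ * N γ β‖ ≤ ∑ γ, ‖M α γ * N γ β‖ := norm_sum_le _ _
    _ ≤ ∑ _γ : ι, m * m' := Finset.sum_le_sum fun γ _ => by
        rw [norm_mul]; exact mul_le_mul (hM α γ) (hN γ β) (norm_nonneg _) h0
    _ = Fintype.card ι * (m * m') := by rw [Finset.sum_const, Finset.card_univ, nsmul_eq_mul]

variable {x₀ x₁ x₂ x₃ y₀ y₁ y₂ y₃ : ℝ}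
  (bX0 : ∀ α β, ‖X₀ t α β‖ ≤ x₀) (bX1 : ∀ α β, ‖X₁ t α β‖ ≤ x₁) (bX2 : ∀ α β, ‖X₂ t α β‖ ≤ x₂) (bX3 : ∀ α β, ‖X₃ t α β‖ ≤ x₃)
  (bY0 : ∀ α β, ‖Y₀ t α β‖ ≤ y₀) (bY1 : ∀ α β, ‖Y₁ t α β‖ ≤ y₁) (bY2 : ∀ α β, ‖Y₂ t α β‖ ≤ y₂) (bY3 : ∀ α β, ‖Y₃ t α β‖ ≤ y₃)

include bX0 bX1 bY0 bY1 in
omit [DecidableEq ι] in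
/-- [folklore] `‖mm1 α β‖ ≤ n·(x₁y₀ + x₀y₁)`. -/
theorem norm_mm1_le (α β : ι) : ‖mm1 X₀ X₁ Y₀ Y₁ t α β‖ ≤ Fintype.card ι * (x₁ * y₀ + x₀ * y₁) := by
  unfold mm1; rw [Matrix.add_apply]
  have := norm_add_le_of_le (norm_mul_entry_le bX1 bY0 α β) (norm_mul_entry_le bX0 bY1 α β)
  linarith

include bX0 bX1 bX2 bY0 bY1 bY2 in
omit [DecidableEq ι] in
/-- [folklore] `‖mm2 α β‖ ≤ n·(x₂y₀ + 2x₁y₁ + x₀y₂)`. -/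
theorem norm_mm2_le (α β : ι) : ‖mm2 X₀ X₁ X₂ Y₀ Y₁ Y₂ t α β‖ ≤ Fintype.card ι * (x₂ * y₀ + 2 * (x₁ * y₁) + x₀ * y₂) := by
  unfold mm2; simp only [Matrix.add_apply]
  have := norm_add_le_of_le (norm_add_le_of_le (norm_mul_entry_le bX2 bY0 α β) (norm_mul_entry_le bX1 bY1 α β))
    (norm_add_le_of_le (norm_mul_entry_le bX1 bY1 α β) (norm_mul_entry_le bX0 bY2 α β))
  linarith

include bX0 bX1 bX2 bX3 bY0 bY1 bY2 bY3 in
omit [DecidableEq ι] in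
/-- [folklore] `‖mm3 α β‖ ≤ n·(x₃y₀ + 3x₂y₁ + 3x₁y₂ + x₀y₃)`. -/
theorem norm_mm3_le (α β : ι) :
    ‖mm3 X₀ X₁ X₂ X₃ Y₀ Y₁ Y₂ Y₃ t α β‖ ≤ Fintype.card ι * (x₃ * y₀ + 3 * (x₂ * y₁) + 3 * (x₁ * y₂) + x₀ * y₃) := by
  unfold mm3; simp only [Matrix.add_apply]
  have := norm_add_le_of_le
    (norm_add_le_of_le (norm_add_le_of_le (norm_mul_entry_le bX3 bY0 α β) (norm_mul_entry_le bX2 bY1 α β))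
      (norm_add_le_of_le (norm_mul_entry_le bX2 bY1 α β) (norm_mul_entry_le bX1 bY2 α β)))
    (norm_add_le_of_le (norm_add_le_of_le (norm_mul_entry_le bX2 bY1 α β) (norm_mul_entry_le bX1 bY2 α β))
      (norm_add_le_of_le (norm_mul_entry_le bX1 bY2 α β) (norm_mul_entry_le bX0 bY3 α β)))
  linarith

end MM

/-! ## §2 Scalar × scalar (`ℂ`-valued), to order three -/

section SS

variable (u₀ u₁ u₂ u₃ z₀ z₁ z₂ z₃ : ℝ → ℂ)

/-- [our object] `ss1 := u₁z₀ + u₀z₁`. -/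
def ss1 (s : ℝ) : ℂ := u₁ s * z₀ s + u₀ s * z₁ s
/-- [our object] `ss2 := (u₂z₀ + u₁z₁) + (u₁z₁ + u₀z₂)`. -/
def ss2 (s : ℝ) : ℂ := (u₂ s * z₀ s + u₁ s * z₁ s) + (u₁ s * z₁ s + u₀ s * z₂ s)
/-- [our object] `ss3` (eight terms). -/
def ss3 (s : ℝ) : ℂ :=
  ((u₃ s * z₀ s + u₂ s * z₁ s) + (u₂ s * z₁ s + u₁ s * z₂ s)) + ((u₂ s * z₁ s + u₁ s * z₂ s) + (u₁ s * z₂ s + u₀ s * z₃ s))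

variable {u₀ u₁ u₂ u₃ z₀ z₁ z₂ z₃} {t : ℝ}
  (hu0 : HasDerivAt u₀ (u₁ t) t) (hu1 : HasDerivAt u₁ (u₂ t) t) (hu2 : HasDerivAt u₂ (u₃ t) t)
  (hz0 : HasDerivAt z₀ (z₁ t) t) (hz1 : HasDerivAt z₁ (z₂ t) t) (hz2 : HasDerivAt z₂ (z₃ t) t)

include hu0 hz0 in
/-- [folklore] `(u₀z₀)′ = ss1`. -/
theorem hasDerivAt_ss0 : HasDerivAt (fun s => u₀ s * z₀ s) (ss1 u₀ u₁ z₀ z₁ t) t := by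
  unfold ss1; exact hu0.mul hz0

include hu0 hu1 hz0 hz1 in
/-- [folklore] `(ss1)′ = ss2`. -/
theorem hasDerivAt_ss1 : HasDerivAt (ss1 u₀ u₁ z₀ z₁) (ss2 u₀ u₁ u₂ z₀ z₁ z₂ t) t := by
  have h := (hu1.mul hz0).add (hu0.mul hz1)
  have e1 : ss1 u₀ u₁ z₀ z₁ = fun s => u₁ s * z₀ s + u₀ s * z₁ s := rfl
  rw [e1]; unfold ss2; exact h

include hu0 hu1 hu2 hz0 hz1 hz2 in
/-- [folklore] `(ss2)′ = ss3`. -/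
theorem hasDerivAt_ss2 : HasDerivAt (ss2 u₀ u₁ u₂ z₀ z₁ z₂) (ss3 u₀ u₁ u₂ u₃ z₀ z₁ z₂ z₃ t) t := by
  have h := ((hu2.mul hz0).add (hu1.mul hz1)).add ((hu1.mul hz1).add (hu0.mul hz2))
  have e1 : ss2 u₀ u₁ u₂ z₀ z₁ z₂ = fun s => (u₂ s * z₀ s + u₁ s * z₁ s) + (u₁ s * z₁ s + u₀ s * z₂ s) := rfl
  rw [e1]; unfold ss3; exact h

variable {v₀ v₁ v₂ v₃ w₀ w₁ w₂ w₃ : ℝ}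
  (bu0 : ‖u₀ t‖ ≤ v₀) (bu1 : ‖u₁ t‖ ≤ v₁) (bu2 : ‖u₂ t‖ ≤ v₂) (bu3 : ‖u₃ t‖ ≤ v₃)
  (bz0 : ‖z₀ t‖ ≤ w₀) (bz1 : ‖z₁ t‖ ≤ w₁) (bz2 : ‖z₂ t‖ ≤ w₂) (bz3 : ‖z₃ t‖ ≤ w₃)

include bu0 bu1 bz0 bz1 in
/-- [folklore] `‖ss1‖ ≤ v₁w₀ + v₀w₁`. -/
theorem norm_ss1_le : ‖ss1 u₀ u₁ z₀ z₁ t‖ ≤ v₁ * w₀ + v₀ * w₁ := by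
  have nml : ∀ {a b : ℂ} {x y : ℝ}, ‖a‖ ≤ x → ‖b‖ ≤ y → ‖a * b‖ ≤ x * y := fun ha hb => by
    rw [norm_mul]; exact mul_le_mul ha hb (norm_nonneg _) ((norm_nonneg _).trans ha)
  unfold ss1; exact norm_add_le_of_le (nml bu1 bz0) (nml bu0 bz1)

include bu0 bu1 bu2 bz0 bz1 bz2 in
/-- [folklore] `‖ss2‖ ≤ v₂w₀ + 2v₁w₁ + v₀w₂`. -/
theorem norm_ss2_le : ‖ss2 u₀ u₁ u₂ z₀ z₁ z₂ t‖ ≤ v₂ * w₀ + 2 * (v₁ * w₁) + v₀ * w₂ := by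
  have nml : ∀ {a b : ℂ} {x y : ℝ}, ‖a‖ ≤ x → ‖b‖ ≤ y → ‖a * b‖ ≤ x * y := fun ha hb => by
    rw [norm_mul]; exact mul_le_mul ha hb (norm_nonneg _) ((norm_nonneg _).trans ha)
  unfold ss2
  have := norm_add_le_of_le (norm_add_le_of_le (nml bu2 bz0) (nml bu1 bz1))
    (norm_add_le_of_le (nml bu1 bz1) (nml bu0 bz2))
  linarith

include bu0 bu1 bu2 bu3 bz0 bz1 bz2 bz3 in
/-- [folklore] `‖ss3‖ ≤ v₃w₀ + 3v₂w₁ + 3v₁w₂ + v₀w₃`. -/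
theorem norm_ss3_le : ‖ss3 u₀ u₁ u₂ u₃ z₀ z₁ z₂ z₃ t‖ ≤ v₃ * w₀ + 3 * (v₂ * w₁) + 3 * (v₁ * w₂) + v₀ * w₃ := by
  have nml : ∀ {a b : ℂ} {x y : ℝ}, ‖a‖ ≤ x → ‖b‖ ≤ y → ‖a * b‖ ≤ x * y := fun ha hb => by
    rw [norm_mul]; exact mul_le_mul ha hb (norm_nonneg _) ((norm_nonneg _).trans ha)
  unfold ss3
  have := norm_add_le_of_le
    (norm_add_le_of_le (norm_add_le_of_le (nml bu3 bz0) (nml bu2 bz1))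
      (norm_add_le_of_le (nml bu2 bz1) (nml bu1 bz2)))
    (norm_add_le_of_le (norm_add_le_of_le (nml bu2 bz1) (nml bu1 bz2))
      (norm_add_le_of_le (nml bu1 bz2) (nml bu0 bz3)))
  linarith

end SS

/-! ## §4 Power counting -/

section PC

variable {X₀ X₁ X₂ X₃ Y₀ Y₁ Y₂ Y₃ : ℝ → Matrix ι ι ℂ} {t : ℝ} {a b r : ℝ} (hr : 0 < r)
  (pX0 : ∀ α β, ‖X₀ t α β‖ ≤ a / r ^ 2) (pX1 : ∀ α β, ‖X₁ t α β‖ ≤ a / r ^ 3) (pX2 : ∀ α β, ‖X₂ t α β‖ ≤ a / r ^ 4)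
  (pX3 : ∀ α β, ‖X₃ t α β‖ ≤ a / r ^ 5)
  (pY0 : ∀ α β, ‖Y₀ t α β‖ ≤ b * r ^ 4) (pY1 : ∀ α β, ‖Y₁ t α β‖ ≤ b * r ^ 3) (pY2 : ∀ α β, ‖Y₂ t α β‖ ≤ b * r ^ 2)
  (pY3 : ∀ α β, ‖Y₃ t α β‖ ≤ b * r)

include hr pX0 pY0 in
omit [DecidableEq ι] in
/-- [our object] GRADED PRODUCT, order 0: `‖X_j‖ ≤ a∕r^{2+j}`, `‖Y_j‖ ≤ b·r^{4−j}` ⟹ `‖(X₀Y₀) α β‖ ≤ n·a·b·r²`. -/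
theorem norm_mm0_le_pc (α β : ι) : ‖(X₀ t * Y₀ t) α β‖ ≤ Fintype.card ι * (a * b) * r ^ 2 := by
  have h := norm_mul_entry_le pX0 pY0 α β
  have hr0 : r ≠ 0 := hr.ne'
  calc ‖(X₀ t * Y₀ t) α β‖ ≤ Fintype.card ι * (a / r ^ 2 * (b * r ^ 4)) := h
    _ = Fintype.card ι * (a * b) * r ^ 2 := by field_simp

include hr pX0 pX1 pY0 pY1 in
omit [DecidableEq ι] in
/-- [our object] … order 1: `‖mm1 α β‖ ≤ 2·n·a·b·r`. -/
theorem norm_mm1_le_pc (α β : ι) : ‖mm1 X₀ X₁ Y₀ Y₁ t α β‖ ≤ 2 * (Fintype.card ι * (a * b)) * r := by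
  have h := norm_mm1_le pX0 pX1 pY0 pY1 α β
  have hr0 : r ≠ 0 := hr.ne'
  calc ‖mm1 X₀ X₁ Y₀ Y₁ t α β‖ ≤ Fintype.card ι * (a / r ^ 3 * (b * r ^ 4) + a / r ^ 2 * (b * r ^ 3)) := h
    _ = 2 * (Fintype.card ι * (a * b)) * r := by field_simp; ring

include hr pX0 pX1 pX2 pY0 pY1 pY2 in
omit [DecidableEq ι] in
/-- [our object] … order 2: `‖mm2 α β‖ ≤ 4·n·a·b`. -/
theorem norm_mm2_le_pc (α β : ι) : ‖mm2 X₀ X₁ X₂ Y₀ Y₁ Y₂ t α β‖ ≤ 4 * (Fintype.card ι * (a * b)) := by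
  have h := norm_mm2_le pX0 pX1 pX2 pY0 pY1 pY2 α β
  have hr0 : r ≠ 0 := hr.ne'
  calc ‖mm2 X₀ X₁ X₂ Y₀ Y₁ Y₂ t α β‖
      ≤ Fintype.card ι * (a / r ^ 4 * (b * r ^ 4) + 2 * (a / r ^ 3 * (b * r ^ 3)) + a / r ^ 2 * (b * r ^ 2)) := h
    _ = 4 * (Fintype.card ι * (a * b)) := by field_simp; ring

include hr pX0 pX1 pX2 pX3 pY0 pY1 pY2 pY3 in
omit [DecidableEq ι] in
/-- [our object] … order 3: `‖mm3 α β‖ ≤ 8·n·a·b ∕ r`. -/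
theorem norm_mm3_le_pc (α β : ι) : ‖mm3 X₀ X₁ X₂ X₃ Y₀ Y₁ Y₂ Y₃ t α β‖ ≤ 8 * (Fintype.card ι * (a * b)) / r := by
  have h := norm_mm3_le pX0 pX1 pX2 pX3 pY0 pY1 pY2 pY3 α β
  have hr0 : r ≠ 0 := hr.ne'
  calc ‖mm3 X₀ X₁ X₂ X₃ Y₀ Y₁ Y₂ Y₃ t α β‖
      ≤ Fintype.card ι * (a / r ^ 5 * (b * r ^ 4) + 3 * (a / r ^ 4 * (b * r ^ 3)) + 3 * (a / r ^ 3 * (b * r ^ 2)) + a / r ^ 2 * (b * r)) := h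
    _ = 8 * (Fintype.card ι * (a * b)) / r := by field_simp; ring

variable {u₀ u₁ u₂ u₃ z₀ z₁ z₂ z₃ : ℝ → ℂ} {K c : ℝ}
  (pu0 : ‖u₀ t‖ ≤ K * r ^ 2) (pu1 : ‖u₁ t‖ ≤ 2 * K * r) (pu2 : ‖u₂ t‖ ≤ 4 * K) (pu3 : ‖u₃ t‖ ≤ 8 * K / r)
  (pz0 : ‖z₀ t‖ ≤ c / r ^ 2) (pz1 : ‖z₁ t‖ ≤ c / r ^ 3) (pz2 : ‖z₂ t‖ ≤ c / r ^ 4) (pz3 : ‖z₃ t‖ ≤ c / r ^ 5)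

include hr pu0 pz0 in
/-- [our object] GRADED SCALAR PRODUCT, order 0 (letters `|u_j| ≤ 2^j·K·r^{2−j}` as above, `|z_j| ≤ c∕r^{2+j}`): `‖u₀z₀‖ ≤ K·c`. -/
theorem norm_ss0_le_pc : ‖u₀ t * z₀ t‖ ≤ K * c := by
  have nml : ∀ {a b : ℂ} {x y : ℝ}, ‖a‖ ≤ x → ‖b‖ ≤ y → ‖a * b‖ ≤ x * y := fun ha hb => by
    rw [norm_mul]; exact mul_le_mul ha hb (norm_nonneg _) ((norm_nonneg _).trans ha)
  have h := nml pu0 pz0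
  have hr0 : r ≠ 0 := hr.ne'
  calc ‖u₀ t * z₀ t‖ ≤ K * r ^ 2 * (c / r ^ 2) := h
    _ = K * c := by field_simp

include hr pu0 pu1 pz0 pz1 in
/-- [our object] … order 1: `‖ss1‖ ≤ 3·K·c ∕ r`. -/
theorem norm_ss1_le_pc : ‖ss1 u₀ u₁ z₀ z₁ t‖ ≤ 3 * (K * c) / r := by
  have h := norm_ss1_le pu0 pu1 pz0 pz1
  have hr0 : r ≠ 0 := hr.ne'
  calc ‖ss1 u₀ u₁ z₀ z₁ t‖ ≤ 2 * K * r * (c / r ^ 2) + K * r ^ 2 * (c / r ^ 3) := h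
    _ = 3 * (K * c) / r := by field_simp; ring

include hr pu0 pu1 pu2 pz0 pz1 pz2 in
/-- [our object] … order 2: `‖ss2‖ ≤ 9·K·c ∕ r²`. -/
theorem norm_ss2_le_pc : ‖ss2 u₀ u₁ u₂ z₀ z₁ z₂ t‖ ≤ 9 * (K * c) / r ^ 2 := by
  have h := norm_ss2_le pu0 pu1 pu2 pz0 pz1 pz2
  have hr0 : r ≠ 0 := hr.ne'
  calc ‖ss2 u₀ u₁ u₂ z₀ z₁ z₂ t‖ ≤ 4 * K * (c / r ^ 2) + 2 * (2 * K * r * (c / r ^ 3)) + K * r ^ 2 * (c / r ^ 4) := h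
    _ = 9 * (K * c) / r ^ 2 := by field_simp; ring

include hr pu0 pu1 pu2 pu3 pz0 pz1 pz2 pz3 in
/-- [our object] … order 3: `‖ss3‖ ≤ 27·K·c ∕ r³`. -/
theorem norm_ss3_le_pc : ‖ss3 u₀ u₁ u₂ u₃ z₀ z₁ z₂ z₃ t‖ ≤ 27 * (K * c) / r ^ 3 := by
  have h := norm_ss3_le pu0 pu1 pu2 pu3 pz0 pz1 pz2 pz3
  have hr0 : r ≠ 0 := hr.ne'
  calc ‖ss3 u₀ u₁ u₂ u₃ z₀ z₁ z₂ z₃ t‖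
      ≤ 8 * K / r * (c / r ^ 2) + 3 * (4 * K * (c / r ^ 3)) + 3 * (2 * K * r * (c / r ^ 4)) + K * r ^ 2 * (c / r ^ 5) := h
    _ = 27 * (K * c) / r ^ 3 := by field_simp; ring

end PC

end Summit.QuantumFields.BalabanUV.Beta.FP.SliceLeibnizChain

end
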